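import Summits.ResolutionOfSingularities.ResolutionOfSingularities.Theorems.PurelyInseparableDim4ChartChainShape
import Summits.ResolutionOfSingularities.ResolutionOfSingularities.Theorems.PurelyInseparableDim4CoordinateSNCTranslated
import HarnessLib

/-!
# Purely inseparable four-folds `z^p + F(x₁, …, x₄)`: the TRANSLATED boundary shape — the FC-1 input discharged
# on chains `S.erase j ⊆ S₁ ⊆ S₂ ⊆ …` (brick TY-2 (h) part 7b of cell `res-dim4-pi`)

[OURS · counted 0] (D-0157 DOOR 2; director-resolution DR-157-C; desk caveat FC-1 «boundary amnesia»). Sequel of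
`PurelyInseparableDim4ChartChainShape.lean` (shape with UNTRANSLATED members `V(xᵢ)`, `i ∈ S'`) and
`PurelyInseparableDim4CoordinateSNCTranslated.lean`. The boundary members the walk's presented state forgets are
translated coordinate hyperplanes `V(xᵢ + c)` on the chart; when `i` is NOT a variable of the next centre they MEET
it, and their simple normal crossings with it are the content of `hasSNCWith_translatedHyperplanes_𝓘Λ`. The
TRANSLATED SHAPE of a boundary `E` relative to `(φ, S')`: there are an index `idx D` and a constant `cst D` for
each member such that every member EITHER reads `V(x_{idx D} + cst D)` on the chart with `cst D = 0` whenever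
`idx D ∈ S'`, OR misses `φ(V(z, x_{S'}))`; and `idx` is injective on the members of the first kind. PROVED here
(no `sorry`, no new axiom):

* **`hasSNCWith_globalCentre_of_shapeT`** — TRANSLATED SHAPE + `HasSNC E` + closedness ⇒ `HasSNCWith E Z_c`
  (one translation vector straightens all members of the first kind at once — this is where the injectivity of
  `idx` is used; the others are disjoint from the centre, `HasSNCWith.of_disjoint`);
* **`shapeT_transform`** — the translated shape PROPAGATES along a step with `S' ⊆ S''` (new exceptional:
  `(j', 0)`; old `(i, c)`: `i = j'` ⇒ misses the chart; `i ∈ S' ∖ j'` ⇒ `(i, b'ᵢ)` if `b'ᵢ = 0` else misses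
  `V(z, x_{S''})`; `i ∉ S'` ⇒ `(i, c + b'ᵢ)` (`comap_translate_hyperplane_chart`) unless `i ∈ S''` and
  `c + b'ᵢ ≠ 0`, in which case it misses; members missing the old centre keep missing);
* **`shapeT_start`** — after the FIRST blow-up (`𝔸⁵` along `V(z, x_S)`, chart `j`), the boundary `[E]` has the
  translated shape relative to EVERY `S₁` (index `j`, constant `0`) — no condition `j ∈ S₁`.

With `monotone_chain_step`'s assembly pattern this makes every branch `S.erase j ⊆ S₁ ⊆ S₂ ⊆ …` (first step free
to drop the chart variable, e.g. «blow up the point, then the transversal curve, then sections over it») an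
`IsMultipleBlowup` with no snc hypothesis (`chainT_step` below). Nothing here is a statement about resolution of
singularities in dimension ≥ 4 / characteristic `p` (NOT proved anywhere in this programme). bears_on:
LADDER-RESOLUTION:D157-DOOR2 (res-dim4-pi). Supports stmt-ResolutionOfSingularities-16155 (helper, TY-2 (h)).
-/

-- every declaration of this summit lives under `Summit.ResolutionOfSingularities.ResolutionOfSingularities`
-- (summit = problem), which the duplicate-namespace linter flags; house convention (cf. the Target file).
set_option linter.dupNamespace false

noncomputable section

open MvPolynomial Finset CategoryTheory AlgebraicGeometry Opposite TopologicalSpace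
open AlgebraicGeometry.Scheme.IdealSheafData (ofIdealTop vanishingIdeal)

namespace Summit.ResolutionOfSingularities.ResolutionOfSingularities.Theorems.PIDim4

open Literature.AlgebraicGeometry.Resolution
open Literature.AlgebraicGeometry.Resolution.AffinePointBlowup (P A γ coord Wtop)

namespace ChartDictionary

section ShapeT

variable {K : Type} [Field K] {Z W₂ : Scheme.{0}} (φ : P 4 K ⟶ Z) [IsOpenImmersion φ] {π₂ : W₂ ⟶ Z}
  {S' S'' : Finset (Fin 4)} {j' : Fin 4}

/-- **TRANSLATED SHAPE ⇒ the FC-1 input.** Let `E` have simple normal crossings on `Z` and `φ(V(z, x_{S'}))` be closed.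
Suppose there are `idx`, `cst` such that every member of `E` MEETING `φ(V(z, x_{S'}))` reads `V(x_{idx D} + cst D)` on
the chart, with `cst D = 0` when `idx D ∈ S'`, and `idx` is injective on those members. Then `E` has simple normal
crossings with the global centre `Z_c` (one translation vector, vanishing on the centre variables, straightens all
meeting members at once; the others are disjoint from the centre). -/
theorem hasSNCWith_globalCentre_of_shapeT
    (hT : IsClosed (φ '' (AffineCoordBlowup.CΛ 4 K (insert 0 (Fin.succ '' (S' : Set (Fin 4)))) : Set (P 4 K))))
    {E : List Z.IdealSheafData} (hE : HasSNC E) (idx : Z.IdealSheafData → Fin 4) (cst : Z.IdealSheafData → K)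
    (hshape : ∀ D ∈ E,
      ((D.support : Set Z) ∩ φ '' (AffineCoordBlowup.CΛ 4 K (insert 0 (Fin.succ '' (S' : Set (Fin 4)))) : Set (P 4 K))).Nonempty →
      D.comap φ = ofIdealTop (Ideal.span {(γ 4 K).symm (X (idx D).succ + C (cst D))}) ∧ (idx D ∈ S' → cst D = 0))
    (hinj : ∀ D₁ ∈ E, ∀ D₂ ∈ E,
      ((D₁.support : Set Z) ∩ φ '' (AffineCoordBlowup.CΛ 4 K (insert 0 (Fin.succ '' (S' : Set (Fin 4)))) : Set (P 4 K))).Nonempty →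
      ((D₂.support : Set Z) ∩ φ '' (AffineCoordBlowup.CΛ 4 K (insert 0 (Fin.succ '' (S' : Set (Fin 4)))) : Set (P 4 K))).Nonempty →
      idx D₁ = idx D₂ → D₁ = D₂) :
    HasSNCWith E (vanishingIdeal (closureImage φ
      ((AffineCoordBlowup.𝓘Λ 4 K (insert 0 (Fin.succ '' (S' : Set (Fin 4))))).support : Set (P 4 K)))) := by
  classical
  -- the members meeting the centre
  set M1 : Z.IdealSheafData → Prop := fun D =>
    ((D.support : Set Z) ∩ φ '' (AffineCoordBlowup.CΛ 4 K (insert 0 (Fin.succ '' (S' : Set (Fin 4)))) : Set (P 4 K))).Nonempty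
    with hM1
  set E' := E.filter (fun D => decide (M1 D)) with hE'
  have hmemE' : ∀ D, D ∈ E' ↔ D ∈ E ∧ M1 D := by
    intro D; rw [hE', List.mem_filter, decide_eq_true_iff]
  have hE'snc : HasSNC E' := HasSNC.of_subset (fun D hD => ((hmemE' D).mp hD).1) hE
  -- ONE translation vector for all of them
  let c : Fin (4 + 1) → K := Fin.cases 0 fun i => if h : ∃ D ∈ E', idx D = i then cst h.choose else 0
  have hc : ∀ D ∈ E', c (idx D).succ = cst D := by
    intro D hD
    have hex : ∃ D' ∈ E', idx D' = idx D := ⟨D, hD, rfl⟩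
    simp only [c, Fin.cases_succ, dif_pos hex]
    obtain ⟨hD'mem, hD'idx⟩ := hex.choose_spec
    rw [hinj _ ((hmemE' _).mp hD'mem).1 D ((hmemE' _).mp hD).1 ((hmemE' _).mp hD'mem).2 ((hmemE' _).mp hD).2 hD'idx]
  have hcΛ : ∀ k ∈ (insert 0 (Fin.succ '' (S' : Set (Fin 4))) : Set (Fin (4 + 1))), c k = 0 := by
    rintro k (rfl | ⟨i, hi, rfl⟩)
    · rfl
    · simp only [c, Fin.cases_succ]
      split_ifs with h
      · obtain ⟨hD'mem, hD'idx⟩ := h.choose_spec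
        exact (hshape _ ((hmemE' _).mp hD'mem).1 ((hmemE' _).mp hD'mem).2).2 (hD'idx.symm ▸ hi)
      · rfl
  have hmap : E'.map (·.comap φ) =
      (E'.map fun D => (idx D).succ).map (fun k => ofIdealTop (Ideal.span {(γ 4 K).symm (X k + C (c k))})) := by
    rw [List.map_map]
    exact List.map_congr_left fun D hD => by
      rw [Function.comp_apply, hc D hD]
      exact (hshape D ((hmemE' D).mp hD).1 ((hmemE' D).mp hD).2).1
  have hEc : HasSNCWith (E'.map (·.comap φ)) (AffineCoordBlowup.𝓘Λ 4 K (insert 0 (Fin.succ '' (S' : Set (Fin 4))))) := by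
    rw [hmap]
    exact hasSNCWith_translatedHyperplanes_𝓘Λ _ c _ hcΛ
  refine HasSNCWith.of_disjoint (hasSNCWith_globalCentre φ hT hE'snc hEc) hE fun D hD hD' => ?_
  have h2 : ¬ M1 D := fun h => hD' ((hmemE' D).mpr ⟨hD, h⟩)
  rw [coe_support_globalCentre φ hT]
  exact Set.not_nonempty_iff_eq_empty.mp h2

/-- **TRANSLATED SHAPE PROPAGATES along a step with `S' ⊆ S''`.** -/
theorem shapeT_transform [IsLocallyNoetherian Z]
    (hT : IsClosed (φ '' (AffineCoordBlowup.CΛ 4 K (insert 0 (Fin.succ '' (S' : Set (Fin 4)))) : Set (P 4 K))))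
    (hπ₂ : IsBlowup π₂ (vanishingIdeal (closureImage φ
      ((AffineCoordBlowup.𝓘Λ 4 K (insert 0 (Fin.succ '' (S' : Set (Fin 4))))).support : Set (P 4 K)))))
    (hj' : j' ∈ S') {b' : Fin 4 → K} (hbj' : b' j' = 0) {Θ' : A 4 K ≃ₐ[K] A 4 K}
    (hs' : ∀ i : Fin 4, Θ' (X i.succ) = X i.succ + C (b' i)) (hsub : S' ⊆ S'') {E : List Z.IdealSheafData}
    (idx : Z.IdealSheafData → Fin 4) (cst : Z.IdealSheafData → K)
    (hshape : ∀ D ∈ E,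
      ((D.support : Set Z) ∩ φ '' (AffineCoordBlowup.CΛ 4 K (insert 0 (Fin.succ '' (S' : Set (Fin 4)))) : Set (P 4 K))).Nonempty →
      D.comap φ = ofIdealTop (Ideal.span {(γ 4 K).symm (X (idx D).succ + C (cst D))}) ∧ (idx D ∈ S' → cst D = 0))
    (hinj : ∀ D₁ ∈ E, ∀ D₂ ∈ E,
      ((D₁.support : Set Z) ∩ φ '' (AffineCoordBlowup.CΛ 4 K (insert 0 (Fin.succ '' (S' : Set (Fin 4)))) : Set (P 4 K))).Nonempty →
      ((D₂.support : Set Z) ∩ φ '' (AffineCoordBlowup.CΛ 4 K (insert 0 (Fin.succ '' (S' : Set (Fin 4)))) : Set (P 4 K))).Nonempty →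
      idx D₁ = idx D₂ → D₁ = D₂) :
    ∃ (idx₂ : W₂.IdealSheafData → Fin 4) (cst₂ : W₂.IdealSheafData → K),
      (∀ D₂ ∈ E.map (strictTransformIdeal π₂ (vanishingIdeal (closureImage φ
          ((AffineCoordBlowup.𝓘Λ 4 K (insert 0 (Fin.succ '' (S' : Set (Fin 4))))).support : Set (P 4 K))))) ++
        [(vanishingIdeal (closureImage φ
          ((AffineCoordBlowup.𝓘Λ 4 K (insert 0 (Fin.succ '' (S' : Set (Fin 4))))).support : Set (P 4 K)))).comap π₂],
        ((D₂.support : Set W₂) ∩ (Spec.map (CommRingCat.ofHom (Θ' : A 4 K →+* A 4 K)) ≫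
            AffineCoordBlowup.chartImm (isBlowup_restrict_globalCentre φ _ hπ₂) (succ_mem_centreVars hj') ≫
              (π₂ ⁻¹ᵁ φ.opensRange).ι) ''
          (AffineCoordBlowup.CΛ 4 K (insert 0 (Fin.succ '' (S'' : Set (Fin 4)))) : Set (P 4 K))).Nonempty →
        D₂.comap (Spec.map (CommRingCat.ofHom (Θ' : A 4 K →+* A 4 K)) ≫
            AffineCoordBlowup.chartImm (isBlowup_restrict_globalCentre φ _ hπ₂) (succ_mem_centreVars hj') ≫
              (π₂ ⁻¹ᵁ φ.opensRange).ι) =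
          ofIdealTop (Ideal.span {(γ 4 K).symm (X (idx₂ D₂).succ + C (cst₂ D₂))}) ∧ (idx₂ D₂ ∈ S'' → cst₂ D₂ = 0)) ∧
      (∀ D₁ ∈ E.map (strictTransformIdeal π₂ (vanishingIdeal (closureImage φ
          ((AffineCoordBlowup.𝓘Λ 4 K (insert 0 (Fin.succ '' (S' : Set (Fin 4))))).support : Set (P 4 K))))) ++
        [(vanishingIdeal (closureImage φ
          ((AffineCoordBlowup.𝓘Λ 4 K (insert 0 (Fin.succ '' (S' : Set (Fin 4))))).support : Set (P 4 K)))).comap π₂],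
        ∀ D₂ ∈ E.map (strictTransformIdeal π₂ (vanishingIdeal (closureImage φ
          ((AffineCoordBlowup.𝓘Λ 4 K (insert 0 (Fin.succ '' (S' : Set (Fin 4))))).support : Set (P 4 K))))) ++
        [(vanishingIdeal (closureImage φ
          ((AffineCoordBlowup.𝓘Λ 4 K (insert 0 (Fin.succ '' (S' : Set (Fin 4))))).support : Set (P 4 K)))).comap π₂],
        ((D₁.support : Set W₂) ∩ (Spec.map (CommRingCat.ofHom (Θ' : A 4 K →+* A 4 K)) ≫
            AffineCoordBlowup.chartImm (isBlowup_restrict_globalCentre φ _ hπ₂) (succ_mem_centreVars hj') ≫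
              (π₂ ⁻¹ᵁ φ.opensRange).ι) ''
          (AffineCoordBlowup.CΛ 4 K (insert 0 (Fin.succ '' (S'' : Set (Fin 4)))) : Set (P 4 K))).Nonempty →
        ((D₂.support : Set W₂) ∩ (Spec.map (CommRingCat.ofHom (Θ' : A 4 K →+* A 4 K)) ≫
            AffineCoordBlowup.chartImm (isBlowup_restrict_globalCentre φ _ hπ₂) (succ_mem_centreVars hj') ≫
              (π₂ ⁻¹ᵁ φ.opensRange).ι) ''
          (AffineCoordBlowup.CΛ 4 K (insert 0 (Fin.succ '' (S'' : Set (Fin 4)))) : Set (P 4 K))).Nonempty →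
        idx₂ D₁ = idx₂ D₂ → D₁ = D₂) := by
  classical
  haveI : IsIso (CommRingCat.ofHom (Θ' : A 4 K →+* A 4 K)) :=
    (inferInstance : IsIso Θ'.toRingEquiv.toCommRingCatIso.hom)
  haveI : IsProper π₂ := hπ₂.isProper
  haveI : IsLocallyNoetherian W₂ := LocallyOfFiniteType.isLocallyNoetherian π₂
  have hs'' : ∀ i : Fin 4, (Θ' : A 4 K →+* A 4 K) (X i.succ) = X i.succ + C (b' i) := fun i => hs' i
  have hΘ'j : (Θ' : A 4 K →+* A 4 K) (X j'.succ) = X j'.succ := by rw [hs'' j', hbj', C_0, add_zero]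
  have hΘC : ∀ r : K, (Θ' : A 4 K →+* A 4 K) (C r) = C r := fun r => Θ'.commutes r
  -- notation
  set Zc := vanishingIdeal (closureImage φ
    ((AffineCoordBlowup.𝓘Λ 4 K (insert 0 (Fin.succ '' (S' : Set (Fin 4))))).support : Set (P 4 K))) with hZc
  set φ'' := Spec.map (CommRingCat.ofHom (Θ' : A 4 K →+* A 4 K)) ≫
    AffineCoordBlowup.chartImm (isBlowup_restrict_globalCentre φ _ hπ₂) (succ_mem_centreVars hj') ≫
      (π₂ ⁻¹ᵁ φ.opensRange).ι with hφ''
  set T' := φ '' (AffineCoordBlowup.CΛ 4 K (insert 0 (Fin.succ '' (S' : Set (Fin 4)))) : Set (P 4 K)) with hT'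
  set T'' := φ'' '' (AffineCoordBlowup.CΛ 4 K (insert 0 (Fin.succ '' (S'' : Set (Fin 4)))) : Set (P 4 K)) with hT''
  -- a strict transform meeting the new centre comes from a member meeting the old one
  have hsub_pre : T'' ⊆ π₂ ⁻¹' T' :=
    image_CΛ_chart_of_chart_subset_preimage φ hT hπ₂ hj' (Θ' : A 4 K →+* A 4 K) hΘ'j (hsub hj')
  have hmeet_old : ∀ D ∈ E, ((strictTransformIdeal π₂ Zc D).support : Set W₂) ∩ T'' |>.Nonempty →
      ((D.support : Set Z) ∩ T').Nonempty := by
    rintro D - ⟨w, hw1, hw2⟩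
    exact ⟨π₂ w, support_strictTransformIdeal_subset_preimage π₂ _ D hw1, hsub_pre hw2⟩
  -- the reading of a strict transform of a meeting member
  have hread : ∀ D ∈ E, ((D.support : Set Z) ∩ T').Nonempty → idx D ≠ j' →
      (strictTransformIdeal π₂ Zc D).comap φ'' =
        ofIdealTop (Ideal.span {(γ 4 K).symm (X (idx D).succ + C (cst D + b' (idx D)))}) := by
    intro D hD hm hij
    obtain ⟨hDi, hcst⟩ := hshape D hD hm
    by_cases hiS : idx D ∈ S'
    · have h0 : cst D = 0 := hcst hiS
      rw [h0, C_0, add_zero] at hDi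
      rw [hφ'', hZc, comap_strictTransformIdeal_hyperplane_chart_of_chart φ hj' hπ₂ hij (hs'' (idx D)) hDi, h0, zero_add]
    · rw [hφ'', hZc, comap_strictTransformIdeal_chart_of_chart φ _ hπ₂, hDi]
      exact comap_translate_hyperplane_chart hj' hiS (cst D) (hs'' (idx D)) hΘC (isBlowup_restrict_globalCentre φ _ hπ₂)
  -- a strict transform of a meeting member with index `j'` misses the chart of the chart
  have hself : ∀ D ∈ E, ((D.support : Set Z) ∩ T').Nonempty → idx D = j' →
      ¬ (((strictTransformIdeal π₂ Zc D).support : Set W₂) ∩ T'').Nonempty := by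
    rintro D hD hm hij ⟨w, hw1, y, hy, rfl⟩
    obtain ⟨hDi, hcst⟩ := hshape D hD hm
    rw [hcst (hij ▸ hj'), C_0, add_zero, hij] at hDi
    have htop := comap_strictTransformIdeal_hyperplane_self_chart_of_chart φ hj' hπ₂ (Θ' : A 4 K →+* A 4 K) hDi
    have h1 : y ∈ ((strictTransformIdeal π₂ Zc D).comap φ'').support := by
      rw [Scheme.IdealSheafData.support_comap]; exact hw1
    rw [hφ'', hZc, htop, Scheme.IdealSheafData.support_top] at h1
    exact h1
  -- preimages of strict transforms among the meeting members
  let pre : W₂.IdealSheafData → Z.IdealSheafData := fun D₂ =>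
    if h : ∃ D ∈ E, ((D.support : Set Z) ∩ T').Nonempty ∧ strictTransformIdeal π₂ Zc D = D₂ then h.choose else ⊤
  have hpre : ∀ D ∈ E, ((D.support : Set Z) ∩ T').Nonempty →
      pre (strictTransformIdeal π₂ Zc D) ∈ E ∧ ((pre (strictTransformIdeal π₂ Zc D)).support ∩ T' : Set Z).Nonempty ∧
        strictTransformIdeal π₂ Zc (pre (strictTransformIdeal π₂ Zc D)) = strictTransformIdeal π₂ Zc D := by
    intro D hD hm
    have hex : ∃ D' ∈ E, ((D'.support : Set Z) ∩ T').Nonempty ∧ strictTransformIdeal π₂ Zc D' = strictTransformIdeal π₂ Zc D :=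
      ⟨D, hD, hm, rfl⟩
    simp only [pre, dif_pos hex]
    exact ⟨hex.choose_spec.1, hex.choose_spec.2.1, hex.choose_spec.2.2⟩
  refine ⟨fun D₂ => if D₂ = Zc.comap π₂ then j' else idx (pre D₂),
    fun D₂ => if D₂ = Zc.comap π₂ then 0 else cst (pre D₂) + b' (idx (pre D₂)), ?_, ?_⟩
  · -- the readings
    intro D₂ hD₂ hm₂
    by_cases hnew : D₂ = Zc.comap π₂
    · subst hnew
      beta_reduce
      rw [if_pos rfl, if_pos rfl]
      refine ⟨?_, fun _ => rfl⟩
      rw [C_0, add_zero, hφ'', hZc, comap_comap_globalCentre_chart_of_chart φ hj' hΘ'j hπ₂]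
      rfl
    · beta_reduce
      rw [if_neg hnew, if_neg hnew]
      rw [List.mem_append, List.mem_map, List.mem_singleton] at hD₂
      rcases hD₂ with ⟨D, hD, rfl⟩ | h
      · have hm : ((D.support : Set Z) ∩ T').Nonempty := hmeet_old D hD hm₂
        obtain ⟨hpE, hpm, hpeq⟩ := hpre D hD hm
        have hpj : idx (pre (strictTransformIdeal π₂ Zc D)) ≠ j' := fun h =>
          hself _ hpE hpm h (hpeq.symm ▸ hm₂)
        have hr := hread _ hpE hpm hpj
        rw [hpeq] at hr
        refine ⟨hr, fun hiS'' => ?_⟩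
        -- meeting `V(z, x_{S''})` with index in `S''` forces the constant to vanish
        by_contra hne
        obtain ⟨w, hw1, y, hy, rfl⟩ := hm₂
        have h1 : y ∈ ((strictTransformIdeal π₂ Zc D).comap φ'').support := by
          rw [Scheme.IdealSheafData.support_comap]; exact hw1
        rw [hr] at h1
        have h0 := support_translate_inter_CΛ_eq_empty (K := K) hne
          (Λ := insert 0 (Fin.succ '' (S'' : Set (Fin 4)))) (Set.mem_insert_of_mem _ ⟨_, hiS'', rfl⟩)
        exact (Set.eq_empty_iff_forall_notMem.mp h0) y ⟨h1, hy⟩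
      · exact absurd h hnew
  · -- injectivity of the new index on the meeting members
    intro D₁ hD₁ D₂ hD₂ hm₁ hm₂ hidx
    -- an old meeting member with new index `j'` cannot meet
    have key : ∀ D₀ ∈ E.map (strictTransformIdeal π₂ Zc) ++ [Zc.comap π₂], D₀ ≠ Zc.comap π₂ →
        (((D₀.support : Set W₂) ∩ T'').Nonempty) →
        pre D₀ ∈ E ∧ (((pre D₀).support : Set Z) ∩ T').Nonempty ∧ strictTransformIdeal π₂ Zc (pre D₀) = D₀ ∧
          idx (pre D₀) ≠ j' := by
      intro D₀ hD₀ hne hm₀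
      rw [List.mem_append, List.mem_map, List.mem_singleton] at hD₀
      rcases hD₀ with ⟨D, hD, rfl⟩ | h
      · obtain ⟨hpE, hpm, hpeq⟩ := hpre D hD (hmeet_old D hD hm₀)
        exact ⟨hpE, hpm, hpeq, fun h => hself _ hpE hpm h (hpeq.symm ▸ hm₀)⟩
      · exact absurd h hne
    by_cases h₁ : D₁ = Zc.comap π₂ <;> by_cases h₂ : D₂ = Zc.comap π₂
    · rw [h₁, h₂]
    · simp only [if_pos h₁, if_neg h₂] at hidx
      exact absurd hidx.symm (key D₂ hD₂ h₂ hm₂).2.2.2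
    · simp only [if_neg h₁, if_pos h₂] at hidx
      exact absurd hidx (key D₁ hD₁ h₁ hm₁).2.2.2
    · simp only [if_neg h₁, if_neg h₂] at hidx
      obtain ⟨hp1E, hp1m, hp1eq, -⟩ := key D₁ hD₁ h₁ hm₁
      obtain ⟨hp2E, hp2m, hp2eq, -⟩ := key D₂ hD₂ h₂ hm₂
      rw [← hp1eq, ← hp2eq, hinj _ hp1E _ hp2E hp1m hp2m hidx]

end ShapeT

end ChartDictionary

end Summit.ResolutionOfSingularities.ResolutionOfSingularities.Theorems.PIDim4

end
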